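import Literature.MathematicalPhysics.QuantumFieldTheory.Balaban1983to89.T4TermwiseDeviation
import Literature.MathematicalPhysics.QuantumFieldTheory.Balaban1983to89.T4CurrencyMatching

/-!
# T⁴ continuum, node U5 (NE7), TERM-WISE member — the route made CURRENCY-GENERIC, and its t-currency twin

Lineage t4-ne7-p1 (term-wise matching modulo constants), generation 5, second leaf.  HONEST FRAMING (page 1): pure YM₄
on a FIXED FINITE torus T⁴, rung (B)+1 of the cell's ladder = the `ε → 0` limit of expectations of gauge-invariant
observables; NOT infinite volume, NOT a mass gap, NOT the Clay problem.  Spine estimate NE7 (node U5: for every `K` a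
`t`-independent constant `c_K` with `|log Z^B_{K+1}(t) − log Z^A_K(t) − c_K| ≤ δ_K·|T₁|`, `Σ_K δ_K < ∞`) is NOT PRINTED
for Bałaban's d = 4 procedure; its d = 2, 3 template is [King1986] (3.10)–(3.13) pp. 656–657 (TEMPLATE ONLY).  Every
estimate below is a HYPOTHESIS BINDER named in the statement; nothing of Bałaban's expansions is asserted; no conditional
(BetaPertH, (B), (B^μ)) is hidden — they sit by name inside the producers of the binders exactly where those modules
declare them.  All declarations are [folklore] bookkeeping (composition of tree theorems).  NO definitions, no cite tags.

## Why this leaf (NE9 seat NOTE, journal l.50057 item (4); `T4CurrencyMatching` §5)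
The lineage's tower theorem `T4TowerRateDischarge.uRateUpTo_of_nodes` (gen 2) and everything assembled on it (gens 3–5,
up to `T4TermwiseDeviation.hasContinuumLimit_of_nodes_witness`) read node U3's shapes — NE9 + fading memory,
Lipschitz-in-the-background, NE5 — for functionals of the COUPLING history `g^A_K = (g_K(i))_i`, and convert node U2's
output `InjectedRate Cd 0 θc (disc g_K g_{K+1})` (a statement about `|1/g_K(i)² − 1/g_{K+1}(i+1)²|`) into the coupling
rate `|g_K(i) − g_{K+1}(i+1)| ≤ γ³Cd·θc^i` on the printed box (`T4TowerRateComposition.couplingRate_pair_of_injectedDisc`).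
On the ANALYTIC MEMBER of the cell, node U3's NE9 arrives in the t-CURRENCY `t = 1/g²`
(`T4CouplingAnalyticity.ne9T_of_dilationStep`, consumed in `T4CurrencyMatching.uRateUpTo_towerT`): functionals of the
t-history `i ↦ 1/g_K(i)²`, and node U2's output is the coupling rate in that currency WITH CONSTANT `Cd` ITSELF
(`T4CurrencyMatching.couplingRateT_of_injectedDisc`).  Feeding the g-currency chain from t-currency NE9 would need the
g ↔ t conversion of the history-Lipschitz moduli (wall W5 of the NE9 seat, GAPS G-ne9p1-8).  This leaf makes the
term-wise route independent of that choice: the TERM-LEDGER HALF (gens 3–5) never looked inside the histories — it only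
evaluates the two functionals at two TABLES `gA K`, `gB K` — so it is restated ONCE over arbitrary tables with the composed
tower rate `URateUpTo K` as a GIVEN family (§2–§3), and the TOWER HALF is restated once over arbitrary tables with an
abstract coupling rate `|gA K i − gB K i| ≤ D·θc^i` (§1).  The g-currency theorems of gens 2–5 are the instance
`gA K = g_K`, `gB K = g_{K+1}(·+1)`, `D = γ³Cd`; the t-currency twin (§1 `uRateUpTo_of_nodesT`, §4) is the instance
`gA K = 1/g_K²`, `gB K = 1/g_{K+1}(·+1)²`, `D = Cd`, with NO box hypothesis and NO W5-type conversion.  Nothing new is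
claimed about print; the content is that the lineage's kernel chain CONSUMES the analytic member's node-U3/U2 outputs in
their native currency.

## What this module adds (additive leaf; imports `T4TermwiseDeviation` (gen 5) and `T4CurrencyMatching` (NE9 seat) BY
## NAME; nothing upstream is edited)
§1 TOWER, ANY CURRENCY.  `uRateUpTo_of_tables`: node U3's shapes on a window `W` of histories, `PolyLipGrowth` of the
   Lipschitz-in-U family along run A's tables, NE3 as `LocalRate` + `GaugeDominated`, both runs' tables in `W`, and an
   abstract coupling rate `|gA K i − gB K i| ≤ D·θc^i` (`i ≤ K`) ⇒ ONE `a ≥ 0` with `URateUpTo K … (a + C₉·D·θ′/(θ′ −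
   max(ω,θc)) + C₅) θ′` for every cutoff (`argBracket_tower` + `uRateUpTo_tower_anyRate`, verbatim the proof of
   `uRateUpTo_of_nodes`).  `uRateUpTo_of_nodesT`: the t-currency instance, node U2's output consumed with constant `Cd`.
§2 TERM LEDGER, GIVEN THE RATE.  `goodClause_summable_of_rate_witness`, `hybridNE7_of_rate_witness`,
   `ne7_of_rate_witness`: generation 5's §4 with the tower binders (T) replaced by the family
   `hUR : ∀ K, URateUpTo K EA EB (gA K) (gB K) (U^A_K) (U^B_K) Adm Cr θ′ κ`, `0 ≤ Cr`, over arbitrary tables; the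
   conclusions carry the GIVEN `Cr` (no `∃`).
§3 ALL STRINGS, GIVEN THE RATE.  `stringHybridNE7_of_rate_witness`, `hasContinuumLimit_of_rate_witness`: generation 5's
   §5 likewise; the node-U0 targets OUTRIGHT from `hUR` + the per-string binders (F)(S)(M)(O)(O′)(W)(L1-pos)(E1/E2) + (F′).
§4 THE t-CURRENCY CAPSTONES.  `ne7_of_nodes_witnessT`, `hasContinuumLimit_of_nodes_witnessT`: §2/§3 fed by
   `uRateUpTo_of_nodesT` — the binders of `T4TermwiseDeviation.ne7_of_nodes_witness` /
   `hasContinuumLimit_of_nodes_witness` with the window, the node-U3 shapes and the term format read on the t-TABLES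
   `i ↦ 1/g_K(i)²`, `i ↦ 1/g_{K+1}(i+1)²` (`T4CurrencyMatching.invSq`), node U2's output as is, and the box binder GONE.
§5 SANITY (v1.1).  `toy_rate_witness_nonvacuous`: a two-point driving-field toy on which EVERY binder of §2's
   `goodClause_summable_of_rate_witness` holds jointly — composed rate, (2.25)-format, one-run size centring, multiplicity,
   the reference witness (F′) at which both runs return the reference configuration, trivial other kinds — with the two
   runs' E-factors DIFFERENT off the witness; the theorem then yields the good clause with a summable remainder.  (The
   joint toy the header of `T4TermwiseDeviation` v1 declared missing; no physics.)

## Binder census of `hasContinuumLimit_of_nodes_witnessT` (every one a hypothesis; which are estimates)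
(T) tower, string-independent, NOT PRINTED as two-run statements: `h9 hΛm hUL hG h5` on the t-window `Wt`, `hloc hgd`
(NE3 + liaison), `hinj` (node U2's output; on the analytic member = `T4CurrencyMatching.injectedRate_of_dilationStep`,
whose own hypotheses [H-dil]/W2–W4 are NOT PRINTED and carry the BetaPertH-type input), `htA htB` (both runs' t-tables
in `Wt`) + signs and the rate window `max(ω,θc) < θ′ < 1`, `θ₅, θ₃ ≤ θ′ ≤ Λ`, `0 < a < 1`.  (F) format
`hfmtA hfmtB hint hsc hposO hoff` (STRUCTURAL: the (2.25)-shape of the E-group factors — LOCATION p. 259 of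
[Balaban1988Convergent]).  (F′) `hwit` the reference witness (STRUCTURAL).  (S) `hS hSle` one-run size centrings.  (M)
`hM` multiplicity.  (O) `hO hRO hrO` other kinds' radii.  (O′) `hdevO` the other kinds' centres — what is left of hazard
H-U5b-1, NOT PRINTED.  (W) `hW` `RelWeightBound` (NOT PRINTED; sibling seats).  (L1-pos) `hA hB`.  (E1/E2) `hZA hZB`.
OUTPUT: node U0's three targets.  Non-vacuity of the generic coupling-rate binder of §1: `gA = gB` (any `D ≥ 0`); of the
rest as recorded in `T4TermwiseDeviation` / `T4TermwiseBudget` / `T4TowerRateDischarge`.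

## What is NOT delivered
Any producer of a binder; in particular NOT the analytic member's [H-dil]/W2–W4, NOT (O′), NOT (W).  The t-currency
Lipschitz growth `PolyLipGrowth CU (1/g_K²) P q` is a binder like its g-currency sibling (cell GAPS G-t4-U3-2).

References (LOCATIONS / TEMPLATE only; nothing here is cited as proving a binder): [King1986] C. King, The U(1) Higgs
model: I. The continuum limit, Commun. Math. Phys. 102 (1986) 649–677, (3.10)–(3.13) pp. 656–657 (template of NE7);
[Balaban1988Convergent] T. Bałaban, Convergent renormalization expansions for lattice gauge theories, Commun. Math. Phys.
119 (1988) 243–285, (2.25) p. 259, (2.43)–(2.46) p. 263 (locations of the one-run shapes and of the unit normalisation).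
-/

open Finset MeasureTheory _root_.Filter _root_.Topology

namespace Literature.MathematicalPhysics.QuantumFieldTheory.Balaban1983to89.T4TermwiseCurrency

open T4OutputRate T4RecentScale T4GoodClassBudget T4CauchySum T4TowerRateComposition T4TowerRateDischarge
  T4TermwiseBudget T4TermwiseClosure T4HybridMatching T4MatchingAssembly T4Crossover T4TermwiseDeviation
open T4CurrencyMatching (invSq couplingRateT_of_injectedDisc)

/-! ## §1 The tower in any currency, and its t-currency instance -/

section Tower

open T4EtaRateMin (Readings LocalRate)
open T4RateLiaison (GaugeDominated)

variable {C : Carriers} {ι X : Type}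

/-- **TERM-WISE MATCHING FROM THE SIBLING NODES' TYPED OUTPUTS, ANY CURRENCY** (the proof of
`T4TowerRateDischarge.uRateUpTo_of_nodes` verbatim, over arbitrary run tables).  Node U3's shapes on a window `W` of
histories — `NE9 EA W κ Λ` with `FadingMemory C₉ ω Λ`, `LipBackground EA W κ CU` with `PolyLipGrowth CU gA P q`,
`NE5 EA EB W κ θ₅ C₅` —, node U1b/NE3 as `LocalRate R C₃ θ₃` (`θ₃ < 1`) with the liaison `GaugeDominated R uA uB`, both
runs' tables `gA K`, `gB K` in `W`, and an ABSTRACT COUPLING RATE `|gA K i − gB K i| ≤ D·θc^i` for `i ≤ K` (in the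
g-currency `D = γ³Cd` by `couplingRate_pair_of_injectedDisc`; in the t-currency `D = Cd` by
`T4CurrencyMatching.couplingRateT_of_injectedDisc`).  Conclusion: for ANY `θ′ > max(ω, θc)` with `θ₅, θ₃ ≤ θ′` ONE
`a ≥ 0` such that `URateUpTo K` holds for every cutoff with constant `a + C₉·D·θ′/(θ′ − max(ω,θc)) + C₅`.  Every
hypothesis is an UNPRINTED cell shape or node output. [folklore] -/
theorem uRateUpTo_of_tables {R : Readings ι X} {W : Set (ℕ → ℝ)} {EA : Functional C C.BgA} {EB : Functional C C.BgB}
    {κ θ₅ C₅ C₉ ω θc D C₃ θ₃ P θ' : ℝ} {q : ℕ} {Λ : ℕ → ℕ → ℝ} {CU : (ℕ → ℝ) → ℕ → ℝ} {gA gB : ℕ → ℕ → ℝ}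
    {uA : ℕ → ι → C.BgA} {uB : ℕ → ι → C.BgB}
    (h9 : NE9 EA W κ Λ) (hΛ : FadingMemory C₉ ω Λ) (hω : 0 ≤ ω)
    (hU : LipBackground EA W κ CU) (hG : PolyLipGrowth CU gA P q) (hP : 0 ≤ P)
    (h5 : NE5 EA EB W κ θ₅ C₅) (hθ₅ : 0 ≤ θ₅) (hC₅ : 0 ≤ C₅)
    (hloc : LocalRate R C₃ θ₃) (hC₃ : 0 ≤ C₃) (hθ₃ : 0 ≤ θ₃) (hθ₃1 : θ₃ < 1) (hgd : GaugeDominated R uA uB)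
    (hcoup : ∀ K i, i ≤ K → |gA K i - gB K i| ≤ D * θc ^ i) (hD : 0 ≤ D) (hθc : 0 ≤ θc)
    (hgA : ∀ K, gA K ∈ W) (hgB : ∀ K, gB K ∈ W)
    (hθ' : max ω θc < θ') (hθ₅' : θ₅ ≤ θ') (hθ₃' : θ₃ ≤ θ') :
    ∃ a : ℝ, 0 ≤ a ∧ ∀ K, URateUpTo K EA EB (gA K) (gB K) (uA K) (uB K) R.dom
      (a + C₉ * D * (θ' / (θ' - max ω θc)) + C₅) θ' κ := by
  have hclose := closeness_of_localRate (C := C) hloc hgd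
  obtain ⟨a, ha0, harg⟩ := argBracket_tower (δc := fun K => C₃ * θ₃ ^ K) hG hP hC₃ hθ₃ hθ₃1 hθ₃'
    (fun K => by positivity) (fun K => le_rfl)
  refine ⟨a, ha0, fun K => ?_⟩
  exact uRateUpTo_tower_anyRate (Adm := fun _ => R.dom) (δc := fun K => C₃ * θ₃ ^ K) h9 hΛ hU h5 hω hθc hθ₅
    (hθ₃.trans hθ₃') hC₅ hD ha0 hθ' hθ₅' le_rfl hgA hgB hcoup hclose (fun K j hj => (hG K j hj).1) harg K

/-- **THE t-CURRENCY INSTANCE** (answer to the NE9 seat's item (4), journal l.50057): node U3's shapes for functionals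
`Et`, `EBt` of the t-HISTORY on a t-window `Wt`, the Lipschitz growth along run A's t-tables `i ↦ 1/g_K(i)²`, NE3 +
liaison, both runs' t-tables in `Wt`, and node U2's NATIVE output `InjectedRate Cd 0 θc (disc g_K g_{K+1})` — consumed with
constant `Cd` itself (`T4CurrencyMatching.couplingRateT_of_injectedDisc`), NO box hypothesis, NO g ↔ t conversion of the
history moduli (the NE9 seat's wall W5 does not occur).  Conclusion: `URateUpTo K Et EBt (1/g_K²) (1/g_{K+1}(·+1)²) …
(a + C₉·Cd·θ′/(θ′ − max(ω,θc)) + C₅) θ′` for every cutoff. [folklore] -/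
theorem uRateUpTo_of_nodesT {R : Readings ι X} {Wt : Set (ℕ → ℝ)} {Et : Functional C C.BgA} {EBt : Functional C C.BgB}
    {κ θ₅ C₅ C₉ ω θc Cd C₃ θ₃ P θ' : ℝ} {q : ℕ} {Λ : ℕ → ℕ → ℝ} {CU : (ℕ → ℝ) → ℕ → ℝ} {g : ℕ → ℕ → ℝ}
    {uA : ℕ → ι → C.BgA} {uB : ℕ → ι → C.BgB}
    (h9 : NE9 Et Wt κ Λ) (hΛ : FadingMemory C₉ ω Λ) (hω : 0 ≤ ω)
    (hU : LipBackground Et Wt κ CU) (hG : PolyLipGrowth CU (fun K n => invSq (g K n)) P q) (hP : 0 ≤ P)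
    (h5 : NE5 Et EBt Wt κ θ₅ C₅) (hθ₅ : 0 ≤ θ₅) (hC₅ : 0 ≤ C₅)
    (hloc : LocalRate R C₃ θ₃) (hC₃ : 0 ≤ C₃) (hθ₃ : 0 ≤ θ₃) (hθ₃1 : θ₃ < 1) (hgd : GaugeDominated R uA uB)
    (hinj : InjectedRate Cd 0 θc (fun K j => T4CouplingMatching.disc (g K) (g (K + 1)) j)) (hCd : 0 ≤ Cd)
    (hθc : 0 ≤ θc) (htA : ∀ K, (fun n => invSq (g K n)) ∈ Wt)
    (htB : ∀ K, (fun n => invSq (g (K + 1) (n + 1))) ∈ Wt)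
    (hθ' : max ω θc < θ') (hθ₅' : θ₅ ≤ θ') (hθ₃' : θ₃ ≤ θ') :
    ∃ a : ℝ, 0 ≤ a ∧ ∀ K, URateUpTo K Et EBt (fun n => invSq (g K n)) (fun n => invSq (g (K + 1) (n + 1)))
      (uA K) (uB K) R.dom (a + C₉ * Cd * (θ' / (θ' - max ω θc)) + C₅) θ' κ :=
  uRateUpTo_of_tables (gA := fun K n => invSq (g K n)) (gB := fun K n => invSq (g (K + 1) (n + 1))) h9 hΛ hω hU hG
    hP h5 hθ₅ hC₅ hloc hC₃ hθ₃ hθ₃1 hgd (fun K i hi => couplingRateT_of_injectedDisc hinj K i hi) hCd hθc htA htB hθ'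
    hθ₅' hθ₃'

end Tower

/-! ## §2 The term ledger GIVEN the composed rate (any currency, any tables) -/

section Ledger

variable {C : Carriers} {ι : Type} [MeasurableSpace ι] {σ : Type*} [DecidableEq σ] {l₀ vol : ℝ}
  {T : ℕ → Finset σ} {Bad : ℕ → ℝ → Finset σ} {A B : ℕ → ℝ → σ → ℝ} {μ : ℕ → ℝ → σ → Measure ι}
  {fac : ℕ → ℝ → σ → Finset C.Dom} {Adm : Set ι} {EA : Functional C C.BgA} {EB : Functional C C.BgB}
  {κ θ' Cr : ℝ} {gA gB : ℕ → ℕ → ℝ} {uA : ℕ → ι → C.BgA} {uB : ℕ → ι → C.BgB} {oneA : C.BgA} {oneB : C.BgB}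
  {oA oB : ℕ → ℝ → σ → ι → ℝ} {κ₁ S : ℕ → ℝ → σ → ℕ → ℝ} {cO RO : ℕ → ℝ → σ → ℝ} {rO Wb c₀ s : ℕ → ℝ}
  {Cw E a Λ : ℝ}

/-- **THE GOOD-CLASS HALF WITH `Summable δ′`, GIVEN THE RATE.**  As `T4TermwiseDeviation.goodClause_summable_of_nodes_witness`
with the tower binders (T) replaced by the composed rate family `hUR : ∀ K, URateUpTo K EA EB (gA K) (gB K) (U^A_K) (U^B_K)
Adm Cr θ′ κ` (`0 ≤ Cr`, `0 < θ′ < 1`, `θ′ ≤ Λ`) over ARBITRARY run tables `gA`, `gB`; the term format (F), one-run sizes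
(S), multiplicity (M), other kinds' radii (O) + `Summable rO`, the reference witness (F′), and the other kinds' centring
(O′) with `Summable s`.  OUTPUT: the good clause with `δ′_K = (max(Cw,1)(E + Cr)e_K + rO K) + (max(Cw,1)(E + Cr)e_K +
s K)` for the GIVEN `Cr`, and `Summable δ′`. [folklore] -/
theorem goodClause_summable_of_rate_witness
    (hUR : ∀ K, URateUpTo K EA EB (gA K) (gB K) (uA K) (uB K) Adm Cr θ' κ) (hCr : 0 ≤ Cr)
    (hθ'0 : 0 < θ') (hθ'1 : θ' < 1) (hθ'Λ : θ' ≤ Λ)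
    (hfmtA : ∀ K t τ, A K t τ = ∫ v, (∏ X ∈ fac K t τ,
      Real.exp (EA (gA K) (uA K v) X - EA (gA K) oneA X)) * oA K t τ v ∂(μ K t τ))
    (hfmtB : ∀ K t τ, B K t τ = ∫ v, (∏ X ∈ fac K t τ,
      Real.exp (EB (gB K) (uB K v) X - EB (gB K) oneB X)) * oB K t τ v ∂(μ K t τ))
    (hint : ∀ K t, |t| ≤ l₀ → ∀ τ ∈ T K \ Bad K t,
      Integrable (fun v => (∏ X ∈ fac K t τ, Real.exp (EA (gA K) (uA K v) X - EA (gA K) oneA X)) *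
        oA K t τ v) (μ K t τ) ∧
      Integrable (fun v => (∏ X ∈ fac K t τ, Real.exp (EB (gB K) (uB K v) X - EB (gB K) oneB X)) *
        oB K t τ v) (μ K t τ))
    (hsc : ∀ K t, |t| ≤ l₀ → ∀ τ ∈ T K \ Bad K t, ∀ X ∈ fac K t τ, C.scale X ≤ K)
    (hposO : ∀ K t, |t| ≤ l₀ → ∀ τ ∈ T K \ Bad K t, ∀ v ∈ Adm, 0 < oA K t τ v ∧ 0 < oB K t τ v)
    (hoff : ∀ K t, |t| ≤ l₀ → ∀ τ ∈ T K \ Bad K t, ∀ v, v ∉ Adm →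
      (∏ X ∈ fac K t τ, Real.exp (EA (gA K) (uA K v) X - EA (gA K) oneA X)) * oA K t τ v = 0 ∧
      (∏ X ∈ fac K t τ, Real.exp (EB (gB K) (uB K v) X - EB (gB K) oneB X)) * oB K t τ v = 0)
    (hS : ∀ K t, |t| ≤ l₀ → ∀ τ ∈ T K \ Bad K t, ∀ v ∈ Adm, ∀ j ≤ K,
      |(∑ X ∈ fac K t τ with C.scale X = j,
          (Real.log (Real.exp (EB (gB K) (uB K v) X - EB (gB K) oneB X))
            - Real.log (Real.exp (EA (gA K) (uA K v) X - EA (gA K) oneA X)))) - κ₁ K t τ j| ≤ S K t τ j)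
    (hM : ∀ K t, |t| ≤ l₀ → ∀ τ ∈ T K \ Bad K t,
      Multiplicity (fac K t τ) C.scale (fun X => Real.exp (-(κ * C.d X))) Cw vol Λ K)
    (hwit : ∀ K, ∃ v₁ ∈ Adm, uA K v₁ = oneA ∧ uB K v₁ = oneB)
    (hO : ∀ K t, |t| ≤ l₀ → ∀ τ ∈ T K \ Bad K t, ∀ v ∈ Adm,
      |Real.log (oB K t τ v) - Real.log (oA K t τ v) - cO K t τ| ≤ RO K t τ)
    (hvol : 0 ≤ vol) (hE : 0 ≤ E) (ha0 : 0 < a) (ha1 : a < 1)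
    (hSle : ∀ K t, |t| ≤ l₀ → ∀ τ ∈ T K \ Bad K t, ∀ j ≤ K, S K t τ j ≤ vol * (E * a ^ (K - j)))
    (hRO : ∀ K t, |t| ≤ l₀ → ∀ τ ∈ T K \ Bad K t, RO K t τ ≤ vol * rO K) (hrO : Summable rO)
    (hs : Summable s) (hO' : ∀ K t, |t| ≤ l₀ → ∀ τ ∈ T K \ Bad K t, |cO K t τ - c₀ K| ≤ vol * s K) :
    GoodClause l₀ vol T A B Bad
        (fun K => (max Cw 1 * ((E + Cr) * ∑ x ∈ antidiagonal K, min (a ^ x.2) (θ' ^ x.1 * Λ ^ x.2)) + rO K)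
          + (max Cw 1 * ((E + Cr) * ∑ x ∈ antidiagonal K, min (a ^ x.2) (θ' ^ x.1 * Λ ^ x.2)) + s K)) ∧
      Summable (fun K => (max Cw 1 * ((E + Cr) * ∑ x ∈ antidiagonal K, min (a ^ x.2) (θ' ^ x.1 * Λ ^ x.2))
          + rO K) + (max Cw 1 * ((E + Cr) * ∑ x ∈ antidiagonal K, min (a ^ x.2) (θ' ^ x.1 * Λ ^ x.2))
          + s K)) := by
  have hΛ : 0 ≤ Λ := hθ'0.le.trans hθ'Λ
  have hsumE : Summable (fun K : ℕ => (E + Cr) * ∑ x ∈ antidiagonal K, min (a ^ x.2) (θ' ^ x.1 * Λ ^ x.2)) := by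
    refine (summable_eBranch_poly (p := 0) hE hCr ha0 ha1 hθ'0 hθ'1 hθ'Λ).congr fun K => ?_
    rw [pow_zero, mul_one]
  -- gen 5 §3: the per-term budget fed by the rate, the E-group's share of H-U5b-1 discharged at the witness
  have hTB := termBudget_of_towerRate_witness (gA := gA) (gB := gB)
    (uA := fun K _ _ => uA K) (uB := fun K _ _ => uB K) (Adm := fun _ _ _ => Adm) (Cr := fun _ => Cr)
    hfmtA hfmtB hint hsc hposO hoff hS (fun K t _ τ _ => hUR K) hM (fun K _ _ _ _ => hwit K) hO hvol hE ha0.le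
    hθ'0.le hΛ (fun _ => hCr) hSle hRO hO'
  exact goodClause_summable_of_ledgerBudget (Cr := fun _ => Cr) hTB hsumE hrO ((hsumE.mul_left (max Cw 1)).add hs)

/-- **THE HYBRID SHAPE, GIVEN THE RATE**: as `T4TermwiseDeviation.hybridNE7_of_nodes_witness` with (T) replaced by `hUR` —
plus NE7's weight half (W) `RelWeightBound` (NOT PRINTED; sibling seats) and (L1-pos): `HybridNE7` with ZERO shells and
remainder `δ′` for the GIVEN `Cr` (`hybridNE7_noShell`). [folklore] -/
theorem hybridNE7_of_rate_witness
    (hUR : ∀ K, URateUpTo K EA EB (gA K) (gB K) (uA K) (uB K) Adm Cr θ' κ) (hCr : 0 ≤ Cr)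
    (hθ'0 : 0 < θ') (hθ'1 : θ' < 1) (hθ'Λ : θ' ≤ Λ)
    (hfmtA : ∀ K t τ, A K t τ = ∫ v, (∏ X ∈ fac K t τ,
      Real.exp (EA (gA K) (uA K v) X - EA (gA K) oneA X)) * oA K t τ v ∂(μ K t τ))
    (hfmtB : ∀ K t τ, B K t τ = ∫ v, (∏ X ∈ fac K t τ,
      Real.exp (EB (gB K) (uB K v) X - EB (gB K) oneB X)) * oB K t τ v ∂(μ K t τ))
    (hint : ∀ K t, |t| ≤ l₀ → ∀ τ ∈ T K \ Bad K t,
      Integrable (fun v => (∏ X ∈ fac K t τ, Real.exp (EA (gA K) (uA K v) X - EA (gA K) oneA X)) *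
        oA K t τ v) (μ K t τ) ∧
      Integrable (fun v => (∏ X ∈ fac K t τ, Real.exp (EB (gB K) (uB K v) X - EB (gB K) oneB X)) *
        oB K t τ v) (μ K t τ))
    (hsc : ∀ K t, |t| ≤ l₀ → ∀ τ ∈ T K \ Bad K t, ∀ X ∈ fac K t τ, C.scale X ≤ K)
    (hposO : ∀ K t, |t| ≤ l₀ → ∀ τ ∈ T K \ Bad K t, ∀ v ∈ Adm, 0 < oA K t τ v ∧ 0 < oB K t τ v)
    (hoff : ∀ K t, |t| ≤ l₀ → ∀ τ ∈ T K \ Bad K t, ∀ v, v ∉ Adm →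
      (∏ X ∈ fac K t τ, Real.exp (EA (gA K) (uA K v) X - EA (gA K) oneA X)) * oA K t τ v = 0 ∧
      (∏ X ∈ fac K t τ, Real.exp (EB (gB K) (uB K v) X - EB (gB K) oneB X)) * oB K t τ v = 0)
    (hS : ∀ K t, |t| ≤ l₀ → ∀ τ ∈ T K \ Bad K t, ∀ v ∈ Adm, ∀ j ≤ K,
      |(∑ X ∈ fac K t τ with C.scale X = j,
          (Real.log (Real.exp (EB (gB K) (uB K v) X - EB (gB K) oneB X))
            - Real.log (Real.exp (EA (gA K) (uA K v) X - EA (gA K) oneA X)))) - κ₁ K t τ j| ≤ S K t τ j)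
    (hM : ∀ K t, |t| ≤ l₀ → ∀ τ ∈ T K \ Bad K t,
      Multiplicity (fac K t τ) C.scale (fun X => Real.exp (-(κ * C.d X))) Cw vol Λ K)
    (hwit : ∀ K, ∃ v₁ ∈ Adm, uA K v₁ = oneA ∧ uB K v₁ = oneB)
    (hO : ∀ K t, |t| ≤ l₀ → ∀ τ ∈ T K \ Bad K t, ∀ v ∈ Adm,
      |Real.log (oB K t τ v) - Real.log (oA K t τ v) - cO K t τ| ≤ RO K t τ)
    (hvol : 0 ≤ vol) (hE : 0 ≤ E) (ha0 : 0 < a) (ha1 : a < 1)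
    (hSle : ∀ K t, |t| ≤ l₀ → ∀ τ ∈ T K \ Bad K t, ∀ j ≤ K, S K t τ j ≤ vol * (E * a ^ (K - j)))
    (hRO : ∀ K t, |t| ≤ l₀ → ∀ τ ∈ T K \ Bad K t, RO K t τ ≤ vol * rO K) (hrO : Summable rO)
    (hW : T4WeightBudget.RelWeightBound l₀ T A B Bad Wb)
    (hA : ∀ K t, |t| ≤ l₀ → ∀ τ ∈ T K, 0 ≤ A K t τ) (hB : ∀ K t, |t| ≤ l₀ → ∀ τ ∈ T K, 0 ≤ B K t τ)
    (hs : Summable s) (hO' : ∀ K t, |t| ≤ l₀ → ∀ τ ∈ T K \ Bad K t, |cO K t τ - c₀ K| ≤ vol * s K) :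
    HybridNE7 l₀ vol T A B Bad Wb (fun _ _ _ => 0) (fun _ _ _ => 0) (fun _ => 0)
      (fun K => (max Cw 1 * ((E + Cr) * ∑ x ∈ antidiagonal K, min (a ^ x.2) (θ' ^ x.1 * Λ ^ x.2)) + rO K)
        + (max Cw 1 * ((E + Cr) * ∑ x ∈ antidiagonal K, min (a ^ x.2) (θ' ^ x.1 * Λ ^ x.2)) + s K)) := by
  obtain ⟨hgood, hsum⟩ := goodClause_summable_of_rate_witness hUR hCr hθ'0 hθ'1 hθ'Λ hfmtA hfmtB hint hsc hposO
    hoff hS hM hwit hO hvol hE ha0 ha1 hSle hRO hrO hs hO'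
  exact hybridNE7_noShell hW hA hB hsum hgood

/-- **NE7 ITSELF (`T4CauchySum.MatchingModConstants`) AND NODE U6, GIVEN THE RATE**: as
`T4TermwiseDeviation.ne7_of_nodes_witness` with (T) replaced by `hUR` — the matching modulo `t`-independent constants with
the hybrid remainder `hybridDelta vol δ′ Wb` for the GIVEN `Cr`, its summability, the Cauchy property and uniform
convergence of the generating functions on `|t| ≤ l₀` (`T4GoodClassBudget.cauchy_of_goodClause`).  CONDITIONAL on every
binder named; NE7 is NOT PRINTED. [folklore] -/
theorem ne7_of_rate_witness {Z : ℕ → ℝ → ℝ}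
    (hUR : ∀ K, URateUpTo K EA EB (gA K) (gB K) (uA K) (uB K) Adm Cr θ' κ) (hCr : 0 ≤ Cr)
    (hθ'0 : 0 < θ') (hθ'1 : θ' < 1) (hθ'Λ : θ' ≤ Λ)
    (hfmtA : ∀ K t τ, A K t τ = ∫ v, (∏ X ∈ fac K t τ,
      Real.exp (EA (gA K) (uA K v) X - EA (gA K) oneA X)) * oA K t τ v ∂(μ K t τ))
    (hfmtB : ∀ K t τ, B K t τ = ∫ v, (∏ X ∈ fac K t τ,
      Real.exp (EB (gB K) (uB K v) X - EB (gB K) oneB X)) * oB K t τ v ∂(μ K t τ))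
    (hint : ∀ K t, |t| ≤ l₀ → ∀ τ ∈ T K \ Bad K t,
      Integrable (fun v => (∏ X ∈ fac K t τ, Real.exp (EA (gA K) (uA K v) X - EA (gA K) oneA X)) *
        oA K t τ v) (μ K t τ) ∧
      Integrable (fun v => (∏ X ∈ fac K t τ, Real.exp (EB (gB K) (uB K v) X - EB (gB K) oneB X)) *
        oB K t τ v) (μ K t τ))
    (hsc : ∀ K t, |t| ≤ l₀ → ∀ τ ∈ T K \ Bad K t, ∀ X ∈ fac K t τ, C.scale X ≤ K)
    (hposO : ∀ K t, |t| ≤ l₀ → ∀ τ ∈ T K \ Bad K t, ∀ v ∈ Adm, 0 < oA K t τ v ∧ 0 < oB K t τ v)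
    (hoff : ∀ K t, |t| ≤ l₀ → ∀ τ ∈ T K \ Bad K t, ∀ v, v ∉ Adm →
      (∏ X ∈ fac K t τ, Real.exp (EA (gA K) (uA K v) X - EA (gA K) oneA X)) * oA K t τ v = 0 ∧
      (∏ X ∈ fac K t τ, Real.exp (EB (gB K) (uB K v) X - EB (gB K) oneB X)) * oB K t τ v = 0)
    (hS : ∀ K t, |t| ≤ l₀ → ∀ τ ∈ T K \ Bad K t, ∀ v ∈ Adm, ∀ j ≤ K,
      |(∑ X ∈ fac K t τ with C.scale X = j,
          (Real.log (Real.exp (EB (gB K) (uB K v) X - EB (gB K) oneB X))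
            - Real.log (Real.exp (EA (gA K) (uA K v) X - EA (gA K) oneA X)))) - κ₁ K t τ j| ≤ S K t τ j)
    (hM : ∀ K t, |t| ≤ l₀ → ∀ τ ∈ T K \ Bad K t,
      Multiplicity (fac K t τ) C.scale (fun X => Real.exp (-(κ * C.d X))) Cw vol Λ K)
    (hwit : ∀ K, ∃ v₁ ∈ Adm, uA K v₁ = oneA ∧ uB K v₁ = oneB)
    (hO : ∀ K t, |t| ≤ l₀ → ∀ τ ∈ T K \ Bad K t, ∀ v ∈ Adm,
      |Real.log (oB K t τ v) - Real.log (oA K t τ v) - cO K t τ| ≤ RO K t τ)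
    (hvol : 0 < vol) (hl₀ : 0 ≤ l₀) (hE : 0 ≤ E) (ha0 : 0 < a) (ha1 : a < 1)
    (hSle : ∀ K t, |t| ≤ l₀ → ∀ τ ∈ T K \ Bad K t, ∀ j ≤ K, S K t τ j ≤ vol * (E * a ^ (K - j)))
    (hRO : ∀ K t, |t| ≤ l₀ → ∀ τ ∈ T K \ Bad K t, RO K t τ ≤ vol * rO K) (hrO : Summable rO)
    (hW : T4WeightBudget.RelWeightBound l₀ T A B Bad Wb)
    (hA : ∀ K t, |t| ≤ l₀ → ∀ τ ∈ T K, 0 ≤ A K t τ) (hB : ∀ K t, |t| ≤ l₀ → ∀ τ ∈ T K, 0 ≤ B K t τ)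
    (hZA : ∀ K t, |t| ≤ l₀ → Z K t = ∑ τ ∈ T K, A K t τ)
    (hZB : ∀ K t, |t| ≤ l₀ → Z (K + 1) t = ∑ τ ∈ T K, B K t τ)
    (hpos : ∀ K t, |t| ≤ l₀ → 0 < ∑ τ ∈ T K, A K t τ)
    (hs : Summable s) (hO' : ∀ K t, |t| ≤ l₀ → ∀ τ ∈ T K \ Bad K t, |cO K t τ - c₀ K| ≤ vol * s K) :
    MatchingModConstants vol l₀
        (hybridDelta vol (fun K => (max Cw 1 * ((E + Cr) *
          ∑ x ∈ antidiagonal K, min (a ^ x.2) (θ' ^ x.1 * Λ ^ x.2)) + rO K) + (max Cw 1 * ((E + Cr) *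
          ∑ x ∈ antidiagonal K, min (a ^ x.2) (θ' ^ x.1 * Λ ^ x.2)) + s K)) Wb) Z ∧
      Summable (hybridDelta vol (fun K => (max Cw 1 * ((E + Cr) *
          ∑ x ∈ antidiagonal K, min (a ^ x.2) (θ' ^ x.1 * Λ ^ x.2)) + rO K) + (max Cw 1 * ((E + Cr) *
          ∑ x ∈ antidiagonal K, min (a ^ x.2) (θ' ^ x.1 * Λ ^ x.2)) + s K)) Wb) ∧
      (∀ t : ℝ, |t| ≤ l₀ → CauchySeq fun K => genFun Z K t) ∧
      TendstoUniformlyOn (fun K t => genFun Z K t) (genFunLim Z) atTop {t | |t| ≤ l₀} := by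
  obtain ⟨hgood, hsum⟩ := goodClause_summable_of_rate_witness hUR hCr hθ'0 hθ'1 hθ'Λ hfmtA hfmtB hint hsc hposO
    hoff hS hM hwit hO hvol.le hE ha0 ha1 hSle hRO hrO hs hO'
  exact cauchy_of_goodClause hvol hl₀ hW hZA hZB hA hB hpos hsum hgood

end Ledger

/-! ## §3 All strings of a scheme GIVEN the rate: the node-U0 targets OUTRIGHT -/

section Scheme

open Missing T4Continuum T4Assembly

variable {G : Type*} [GaugeGroup G] [MeasurableSpace G] [HaarData G] {O : Type*}

variable {C : Carriers} {ι : Type} [MeasurableSpace ι] {Adm : Set ι} {EA : Functional C C.BgA} {EB : Functional C C.BgB}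
  {κ θ' Cr : ℝ} {gA gB : ℕ → ℕ → ℝ} {uA : ℕ → ι → C.BgA} {uB : ℕ → ι → C.BgB} {oneA : C.BgA} {oneB : C.BgB}
  {Cw E a Λ : ℝ}

/-- **PER STRING, GIVEN THE RATE**: the binders of `hybridNE7_of_rate_witness` for the term families of ONE string `os`,
the E1/E2 dictionary to `schemeZ Sc os (K₀+K)`, and (O′) for that string give `StringHybridNE7 Sc os l₀ vol K₀`
(`T4MatchingClosure.stringHybridNE7_intro`). [folklore] -/
theorem stringHybridNE7_of_rate_witness {σ : Type} [DecidableEq σ] {l₀ vol : ℝ} {T : ℕ → Finset σ}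
    {Bad : ℕ → ℝ → Finset σ} {A B : ℕ → ℝ → σ → ℝ} {μ : ℕ → ℝ → σ → Measure ι} {fac : ℕ → ℝ → σ → Finset C.Dom}
    {oA oB : ℕ → ℝ → σ → ι → ℝ} {κ₁ S : ℕ → ℝ → σ → ℕ → ℝ} {cO RO : ℕ → ℝ → σ → ℝ} {rO Wb c₀ s : ℕ → ℝ}
    (Sc : TorusScheme G O) (os : List O) (K₀ : ℕ)
    (hUR : ∀ K, URateUpTo K EA EB (gA K) (gB K) (uA K) (uB K) Adm Cr θ' κ) (hCr : 0 ≤ Cr)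
    (hθ'0 : 0 < θ') (hθ'1 : θ' < 1) (hθ'Λ : θ' ≤ Λ)
    (hfmtA : ∀ K t τ, A K t τ = ∫ v, (∏ X ∈ fac K t τ,
      Real.exp (EA (gA K) (uA K v) X - EA (gA K) oneA X)) * oA K t τ v ∂(μ K t τ))
    (hfmtB : ∀ K t τ, B K t τ = ∫ v, (∏ X ∈ fac K t τ,
      Real.exp (EB (gB K) (uB K v) X - EB (gB K) oneB X)) * oB K t τ v ∂(μ K t τ))
    (hint : ∀ K t, |t| ≤ l₀ → ∀ τ ∈ T K \ Bad K t,
      Integrable (fun v => (∏ X ∈ fac K t τ, Real.exp (EA (gA K) (uA K v) X - EA (gA K) oneA X)) *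
        oA K t τ v) (μ K t τ) ∧
      Integrable (fun v => (∏ X ∈ fac K t τ, Real.exp (EB (gB K) (uB K v) X - EB (gB K) oneB X)) *
        oB K t τ v) (μ K t τ))
    (hsc : ∀ K t, |t| ≤ l₀ → ∀ τ ∈ T K \ Bad K t, ∀ X ∈ fac K t τ, C.scale X ≤ K)
    (hposO : ∀ K t, |t| ≤ l₀ → ∀ τ ∈ T K \ Bad K t, ∀ v ∈ Adm, 0 < oA K t τ v ∧ 0 < oB K t τ v)
    (hoff : ∀ K t, |t| ≤ l₀ → ∀ τ ∈ T K \ Bad K t, ∀ v, v ∉ Adm →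
      (∏ X ∈ fac K t τ, Real.exp (EA (gA K) (uA K v) X - EA (gA K) oneA X)) * oA K t τ v = 0 ∧
      (∏ X ∈ fac K t τ, Real.exp (EB (gB K) (uB K v) X - EB (gB K) oneB X)) * oB K t τ v = 0)
    (hS : ∀ K t, |t| ≤ l₀ → ∀ τ ∈ T K \ Bad K t, ∀ v ∈ Adm, ∀ j ≤ K,
      |(∑ X ∈ fac K t τ with C.scale X = j,
          (Real.log (Real.exp (EB (gB K) (uB K v) X - EB (gB K) oneB X))
            - Real.log (Real.exp (EA (gA K) (uA K v) X - EA (gA K) oneA X)))) - κ₁ K t τ j| ≤ S K t τ j)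
    (hM : ∀ K t, |t| ≤ l₀ → ∀ τ ∈ T K \ Bad K t,
      Multiplicity (fac K t τ) C.scale (fun X => Real.exp (-(κ * C.d X))) Cw vol Λ K)
    (hwit : ∀ K, ∃ v₁ ∈ Adm, uA K v₁ = oneA ∧ uB K v₁ = oneB)
    (hO : ∀ K t, |t| ≤ l₀ → ∀ τ ∈ T K \ Bad K t, ∀ v ∈ Adm,
      |Real.log (oB K t τ v) - Real.log (oA K t τ v) - cO K t τ| ≤ RO K t τ)
    (hvol : 0 ≤ vol) (hE : 0 ≤ E) (ha0 : 0 < a) (ha1 : a < 1)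
    (hSle : ∀ K t, |t| ≤ l₀ → ∀ τ ∈ T K \ Bad K t, ∀ j ≤ K, S K t τ j ≤ vol * (E * a ^ (K - j)))
    (hRO : ∀ K t, |t| ≤ l₀ → ∀ τ ∈ T K \ Bad K t, RO K t τ ≤ vol * rO K) (hrO : Summable rO)
    (hW : T4WeightBudget.RelWeightBound l₀ T A B Bad Wb)
    (hA : ∀ K t, |t| ≤ l₀ → ∀ τ ∈ T K, 0 ≤ A K t τ) (hB : ∀ K t, |t| ≤ l₀ → ∀ τ ∈ T K, 0 ≤ B K t τ)
    (hZA : ∀ K t, |t| ≤ l₀ → T4GenFunBounds.schemeZ Sc os (K₀ + K) t = ∑ τ ∈ T K, A K t τ)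
    (hZB : ∀ K t, |t| ≤ l₀ → T4GenFunBounds.schemeZ Sc os (K₀ + K + 1) t = ∑ τ ∈ T K, B K t τ)
    (hs : Summable s) (hO' : ∀ K t, |t| ≤ l₀ → ∀ τ ∈ T K \ Bad K t, |cO K t τ - c₀ K| ≤ vol * s K) :
    StringHybridNE7 Sc os l₀ vol K₀ :=
  T4MatchingClosure.stringHybridNE7_intro Sc os K₀
    (hybridNE7_of_rate_witness hUR hCr hθ'0 hθ'1 hθ'Λ hfmtA hfmtB hint hsc hposO hoff hS hM hwit hO hvol hE ha0 ha1
      hSle hRO hrO hW hA hB hs hO') hZA hZB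

/-- **ALL STRINGS, GIVEN THE RATE — the term-wise route's capstone with the tower ABSTRACTED.**  The composed rate family
`hUR` (string-independent, any currency, any tables; NOT PRINTED), the per-string binders (F)(S)(M)(O)(O′)(W)(L1-pos)
(E1/E2) and the witness (F′) give the node-U0 targets for the scheme: the continuum limit of every joint expectation of
the gauge-invariant observables EXISTS along the full sequence of spacings, limit points are UNIQUE, subsequential limits
AGREE (`T4MatchingAssembly.hasContinuumLimit_of_hybridNE7`; `0 < l₀`, `0 ≤ β_K`, measurable observables bounded by
`1`).  HONEST FRAMING: fixed finite torus, rung (B)+1, CONDITIONAL on every binder named; NE7 NOT PRINTED; nothing here is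
infinite volume, a mass gap, or the Clay problem. [folklore] -/
theorem hasContinuumLimit_of_rate_witness [RegularGaugeGroup G] {σ : List O → Type} [∀ os, DecidableEq (σ os)]
    {l₀ : ℝ} {vol : List O → ℝ} {K₀ : List O → ℕ} {T : (os : List O) → ℕ → Finset (σ os)}
    {Bad : (os : List O) → ℕ → ℝ → Finset (σ os)} {A B : (os : List O) → ℕ → ℝ → σ os → ℝ}
    {μ : (os : List O) → ℕ → ℝ → σ os → Measure ι} {fac : (os : List O) → ℕ → ℝ → σ os → Finset C.Dom}
    {oA oB : (os : List O) → ℕ → ℝ → σ os → ι → ℝ} {κ₁ S : (os : List O) → ℕ → ℝ → σ os → ℕ → ℝ}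
    {cO RO : (os : List O) → ℕ → ℝ → σ os → ℝ} {rO Wb : List O → ℕ → ℝ}
    (Sc : TorusScheme G O) (hβ : ∀ K, 0 ≤ Sc.β K) (hm : ∀ K o, Measurable (Sc.obs K o))
    (h1 : ∀ K o U, |Sc.obs K o U| ≤ 1) (hl₀ : 0 < l₀)
    (hUR : ∀ K, URateUpTo K EA EB (gA K) (gB K) (uA K) (uB K) Adm Cr θ' κ) (hCr : 0 ≤ Cr)
    (hθ'0 : 0 < θ') (hθ'1 : θ' < 1) (hθ'Λ : θ' ≤ Λ) (hE : 0 ≤ E) (ha0 : 0 < a) (ha1 : a < 1)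
    (hwit : ∀ K, ∃ v₁ ∈ Adm, uA K v₁ = oneA ∧ uB K v₁ = oneB)
    (hvol : ∀ os, 0 < vol os)
    (hfmtA : ∀ os K t τ, A os K t τ = ∫ v, (∏ X ∈ fac os K t τ,
      Real.exp (EA (gA K) (uA K v) X - EA (gA K) oneA X)) * oA os K t τ v ∂(μ os K t τ))
    (hfmtB : ∀ os K t τ, B os K t τ = ∫ v, (∏ X ∈ fac os K t τ,
      Real.exp (EB (gB K) (uB K v) X - EB (gB K) oneB X)) * oB os K t τ v ∂(μ os K t τ))
    (hint : ∀ os K t, |t| ≤ l₀ → ∀ τ ∈ T os K \ Bad os K t,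
      Integrable (fun v => (∏ X ∈ fac os K t τ, Real.exp (EA (gA K) (uA K v) X - EA (gA K) oneA X)) *
        oA os K t τ v) (μ os K t τ) ∧
      Integrable (fun v => (∏ X ∈ fac os K t τ, Real.exp (EB (gB K) (uB K v) X - EB (gB K) oneB X)) *
        oB os K t τ v) (μ os K t τ))
    (hsc : ∀ os K t, |t| ≤ l₀ → ∀ τ ∈ T os K \ Bad os K t, ∀ X ∈ fac os K t τ, C.scale X ≤ K)
    (hposO : ∀ os K t, |t| ≤ l₀ → ∀ τ ∈ T os K \ Bad os K t, ∀ v ∈ Adm, 0 < oA os K t τ v ∧ 0 < oB os K t τ v)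
    (hoff : ∀ os K t, |t| ≤ l₀ → ∀ τ ∈ T os K \ Bad os K t, ∀ v, v ∉ Adm →
      (∏ X ∈ fac os K t τ, Real.exp (EA (gA K) (uA K v) X - EA (gA K) oneA X)) * oA os K t τ v = 0 ∧
      (∏ X ∈ fac os K t τ, Real.exp (EB (gB K) (uB K v) X - EB (gB K) oneB X)) * oB os K t τ v = 0)
    (hS : ∀ os K t, |t| ≤ l₀ → ∀ τ ∈ T os K \ Bad os K t, ∀ v ∈ Adm, ∀ j ≤ K,
      |(∑ X ∈ fac os K t τ with C.scale X = j,
          (Real.log (Real.exp (EB (gB K) (uB K v) X - EB (gB K) oneB X))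
            - Real.log (Real.exp (EA (gA K) (uA K v) X - EA (gA K) oneA X)))) - κ₁ os K t τ j| ≤ S os K t τ j)
    (hM : ∀ os K t, |t| ≤ l₀ → ∀ τ ∈ T os K \ Bad os K t,
      Multiplicity (fac os K t τ) C.scale (fun X => Real.exp (-(κ * C.d X))) Cw (vol os) Λ K)
    (hO : ∀ os K t, |t| ≤ l₀ → ∀ τ ∈ T os K \ Bad os K t, ∀ v ∈ Adm,
      |Real.log (oB os K t τ v) - Real.log (oA os K t τ v) - cO os K t τ| ≤ RO os K t τ)
    (hSle : ∀ os K t, |t| ≤ l₀ → ∀ τ ∈ T os K \ Bad os K t, ∀ j ≤ K,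
      S os K t τ j ≤ vol os * (E * a ^ (K - j)))
    (hRO : ∀ os K t, |t| ≤ l₀ → ∀ τ ∈ T os K \ Bad os K t, RO os K t τ ≤ vol os * rO os K)
    (hrO : ∀ os, Summable (rO os))
    (hdevO : ∀ os, ∃ c₀ s : ℕ → ℝ, Summable s ∧
      ∀ K t, |t| ≤ l₀ → ∀ τ ∈ T os K \ Bad os K t, |cO os K t τ - c₀ K| ≤ vol os * s K)
    (hW : ∀ os, T4WeightBudget.RelWeightBound l₀ (T os) (A os) (B os) (Bad os) (Wb os))
    (hA : ∀ os K t, |t| ≤ l₀ → ∀ τ ∈ T os K, 0 ≤ A os K t τ)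
    (hB : ∀ os K t, |t| ≤ l₀ → ∀ τ ∈ T os K, 0 ≤ B os K t τ)
    (hZA : ∀ os K t, |t| ≤ l₀ → T4GenFunBounds.schemeZ Sc os (K₀ os + K) t = ∑ τ ∈ T os K, A os K t τ)
    (hZB : ∀ os K t, |t| ≤ l₀ → T4GenFunBounds.schemeZ Sc os (K₀ os + K + 1) t = ∑ τ ∈ T os K, B os K t τ) :
    HasContinuumLimit Sc ∧ HasUniqueLimitPoints Sc ∧ LimitPointsAgree Sc := by
  refine hasContinuumLimit_of_hybridNE7 Sc hβ hm h1 hl₀ fun os => ?_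
  obtain ⟨c₀, s, hs, hO'⟩ := hdevO os
  exact ⟨vol os, K₀ os, hvol os,
    stringHybridNE7_of_rate_witness Sc os (K₀ os) hUR hCr hθ'0 hθ'1 hθ'Λ (hfmtA os) (hfmtB os) (hint os) (hsc os)
      (hposO os) (hoff os) (hS os) (hM os) hwit (hO os) (hvol os).le hE ha0 ha1 (hSle os) (hRO os) (hrO os) (hW os)
      (hA os) (hB os) (hZA os) (hZB os) hs hO'⟩

end Scheme

/-! ## §4 The t-currency capstones (node U2's output with constant `Cd`, no box binder, no W5) -/

section Currency

open Missing T4Continuum T4Assembly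
open T4EtaRateMin (Readings LocalRate)
open T4RateLiaison (GaugeDominated)

variable {G : Type*} [GaugeGroup G] [MeasurableSpace G] [HaarData G] {O : Type*}

variable {C : Carriers} {ι X : Type} [MeasurableSpace ι] {R : Readings ι X} {Wt : Set (ℕ → ℝ)}
  {Et : Functional C C.BgA} {EBt : Functional C C.BgB} {κ θ₅ C₅ C₉ ω θc Cd C₃ θ₃ P θ' : ℝ} {q : ℕ}
  {Λm : ℕ → ℕ → ℝ} {CU : (ℕ → ℝ) → ℕ → ℝ} {g : ℕ → ℕ → ℝ} {uA : ℕ → ι → C.BgA} {uB : ℕ → ι → C.BgB}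
  {oneA : C.BgA} {oneB : C.BgB} {Cw E a Λ : ℝ}

/-- **NE7 AND NODE U6 ON THE t-CURRENCY TOWER** (one term family): the binders of
`T4TermwiseDeviation.ne7_of_nodes_witness` with the window `Wt`, the node-U3 shapes and the term format read on the
t-TABLES `i ↦ 1/g_K(i)²`, `i ↦ 1/g_{K+1}(i+1)²`, node U2's output `InjectedRate Cd 0 θc (disc g_K g_{K+1})` as is and NO box
binder ⇒ `∃ Cr ≥ 0` (the t-tower's `a₀ + C₉·Cd·θ′/(θ′ − max(ω,θc)) + C₅`, INSIDE the delivered remainder only) with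
`MatchingModConstants vol l₀ (hybridDelta vol δ′ Wb) Z`, `Summable`, `CauchySeq`, `TendstoUniformlyOn` for every (O′)
datum.  CONDITIONAL on every binder named; NE7 is NOT PRINTED. [folklore] -/
theorem ne7_of_nodes_witnessT {σ : Type*} [DecidableEq σ] {l₀ vol : ℝ} {T : ℕ → Finset σ} {Bad : ℕ → ℝ → Finset σ}
    {A B : ℕ → ℝ → σ → ℝ} {μ : ℕ → ℝ → σ → Measure ι} {fac : ℕ → ℝ → σ → Finset C.Dom}
    {oA oB : ℕ → ℝ → σ → ι → ℝ} {κ₁ S : ℕ → ℝ → σ → ℕ → ℝ} {cO RO : ℕ → ℝ → σ → ℝ} {rO Wb : ℕ → ℝ}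
    {Z : ℕ → ℝ → ℝ}
    (h9 : NE9 Et Wt κ Λm) (hΛm : FadingMemory C₉ ω Λm) (hω : 0 ≤ ω)
    (hUL : LipBackground Et Wt κ CU) (hG : PolyLipGrowth CU (fun K n => invSq (g K n)) P q) (hP : 0 ≤ P)
    (h5 : NE5 Et EBt Wt κ θ₅ C₅) (hθ₅ : 0 ≤ θ₅) (hC₅ : 0 ≤ C₅)
    (hloc : LocalRate R C₃ θ₃) (hC₃ : 0 ≤ C₃) (hθ₃ : 0 ≤ θ₃) (hθ₃1 : θ₃ < 1) (hgd : GaugeDominated R uA uB)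
    (hinj : InjectedRate Cd 0 θc (fun K j => T4CouplingMatching.disc (g K) (g (K + 1)) j)) (hCd : 0 ≤ Cd)
    (hθc : 0 ≤ θc) (htA : ∀ K, (fun n => invSq (g K n)) ∈ Wt)
    (htB : ∀ K, (fun n => invSq (g (K + 1) (n + 1))) ∈ Wt)
    (hθ' : max ω θc < θ') (hθ₅' : θ₅ ≤ θ') (hθ₃' : θ₃ ≤ θ')
    (hfmtA : ∀ K t τ, A K t τ = ∫ v, (∏ X ∈ fac K t τ,
      Real.exp (Et (fun n => invSq (g K n)) (uA K v) X - Et (fun n => invSq (g K n)) oneA X)) *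
        oA K t τ v ∂(μ K t τ))
    (hfmtB : ∀ K t τ, B K t τ = ∫ v, (∏ X ∈ fac K t τ,
      Real.exp (EBt (fun n => invSq (g (K + 1) (n + 1))) (uB K v) X
        - EBt (fun n => invSq (g (K + 1) (n + 1))) oneB X)) * oB K t τ v ∂(μ K t τ))
    (hint : ∀ K t, |t| ≤ l₀ → ∀ τ ∈ T K \ Bad K t,
      Integrable (fun v => (∏ X ∈ fac K t τ,
        Real.exp (Et (fun n => invSq (g K n)) (uA K v) X - Et (fun n => invSq (g K n)) oneA X)) *
        oA K t τ v) (μ K t τ) ∧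
      Integrable (fun v => (∏ X ∈ fac K t τ,
        Real.exp (EBt (fun n => invSq (g (K + 1) (n + 1))) (uB K v) X
          - EBt (fun n => invSq (g (K + 1) (n + 1))) oneB X)) * oB K t τ v) (μ K t τ))
    (hsc : ∀ K t, |t| ≤ l₀ → ∀ τ ∈ T K \ Bad K t, ∀ X ∈ fac K t τ, C.scale X ≤ K)
    (hposO : ∀ K t, |t| ≤ l₀ → ∀ τ ∈ T K \ Bad K t, ∀ v ∈ R.dom, 0 < oA K t τ v ∧ 0 < oB K t τ v)
    (hoff : ∀ K t, |t| ≤ l₀ → ∀ τ ∈ T K \ Bad K t, ∀ v, v ∉ R.dom →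
      (∏ X ∈ fac K t τ,
        Real.exp (Et (fun n => invSq (g K n)) (uA K v) X - Et (fun n => invSq (g K n)) oneA X)) *
        oA K t τ v = 0 ∧
      (∏ X ∈ fac K t τ,
        Real.exp (EBt (fun n => invSq (g (K + 1) (n + 1))) (uB K v) X
          - EBt (fun n => invSq (g (K + 1) (n + 1))) oneB X)) * oB K t τ v = 0)
    (hS : ∀ K t, |t| ≤ l₀ → ∀ τ ∈ T K \ Bad K t, ∀ v ∈ R.dom, ∀ j ≤ K,
      |(∑ X ∈ fac K t τ with C.scale X = j,
          (Real.log (Real.exp (EBt (fun n => invSq (g (K + 1) (n + 1))) (uB K v) X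
              - EBt (fun n => invSq (g (K + 1) (n + 1))) oneB X))
            - Real.log (Real.exp (Et (fun n => invSq (g K n)) (uA K v) X
              - Et (fun n => invSq (g K n)) oneA X)))) - κ₁ K t τ j| ≤ S K t τ j)
    (hM : ∀ K t, |t| ≤ l₀ → ∀ τ ∈ T K \ Bad K t,
      Multiplicity (fac K t τ) C.scale (fun X => Real.exp (-(κ * C.d X))) Cw vol Λ K)
    (hwit : ∀ K, ∃ v₁ ∈ R.dom, uA K v₁ = oneA ∧ uB K v₁ = oneB)
    (hO : ∀ K t, |t| ≤ l₀ → ∀ τ ∈ T K \ Bad K t, ∀ v ∈ R.dom,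
      |Real.log (oB K t τ v) - Real.log (oA K t τ v) - cO K t τ| ≤ RO K t τ)
    (hvol : 0 < vol) (hl₀ : 0 ≤ l₀) (hE : 0 ≤ E) (ha0 : 0 < a) (ha1 : a < 1) (hθ'1 : θ' < 1) (hθ'Λ : θ' ≤ Λ)
    (hSle : ∀ K t, |t| ≤ l₀ → ∀ τ ∈ T K \ Bad K t, ∀ j ≤ K, S K t τ j ≤ vol * (E * a ^ (K - j)))
    (hRO : ∀ K t, |t| ≤ l₀ → ∀ τ ∈ T K \ Bad K t, RO K t τ ≤ vol * rO K) (hrO : Summable rO)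
    (hW : T4WeightBudget.RelWeightBound l₀ T A B Bad Wb)
    (hA : ∀ K t, |t| ≤ l₀ → ∀ τ ∈ T K, 0 ≤ A K t τ) (hB : ∀ K t, |t| ≤ l₀ → ∀ τ ∈ T K, 0 ≤ B K t τ)
    (hZA : ∀ K t, |t| ≤ l₀ → Z K t = ∑ τ ∈ T K, A K t τ)
    (hZB : ∀ K t, |t| ≤ l₀ → Z (K + 1) t = ∑ τ ∈ T K, B K t τ)
    (hpos : ∀ K t, |t| ≤ l₀ → 0 < ∑ τ ∈ T K, A K t τ) :
    ∃ Cr : ℝ, 0 ≤ Cr ∧ ∀ c₀ s : ℕ → ℝ, Summable s →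
      (∀ K t, |t| ≤ l₀ → ∀ τ ∈ T K \ Bad K t, |cO K t τ - c₀ K| ≤ vol * s K) →
      MatchingModConstants vol l₀
          (hybridDelta vol (fun K => (max Cw 1 * ((E + Cr) *
            ∑ x ∈ antidiagonal K, min (a ^ x.2) (θ' ^ x.1 * Λ ^ x.2)) + rO K) + (max Cw 1 * ((E + Cr) *
            ∑ x ∈ antidiagonal K, min (a ^ x.2) (θ' ^ x.1 * Λ ^ x.2)) + s K)) Wb) Z ∧
        Summable (hybridDelta vol (fun K => (max Cw 1 * ((E + Cr) *
            ∑ x ∈ antidiagonal K, min (a ^ x.2) (θ' ^ x.1 * Λ ^ x.2)) + rO K) + (max Cw 1 * ((E + Cr) *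
            ∑ x ∈ antidiagonal K, min (a ^ x.2) (θ' ^ x.1 * Λ ^ x.2)) + s K)) Wb) ∧
        (∀ t : ℝ, |t| ≤ l₀ → CauchySeq fun K => genFun Z K t) ∧
        TendstoUniformlyOn (fun K t => genFun Z K t) (genFunLim Z) atTop {t | |t| ≤ l₀} := by
  obtain ⟨a₀, ha₀, hUK⟩ := uRateUpTo_of_nodesT h9 hΛm hω hUL hG hP h5 hθ₅ hC₅ hloc hC₃ hθ₃ hθ₃1 hgd hinj hCd hθc
    htA htB hθ' hθ₅' hθ₃'
  have hθ'0 : 0 < θ' := lt_of_le_of_lt (hθc.trans (le_max_right ω θc)) hθ'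
  have hC₉ : 0 ≤ C₉ := fadingMemory_const_nonneg hΛm
  have hCr : 0 ≤ a₀ + C₉ * Cd * (θ' / (θ' - max ω θc)) + C₅ :=
    add_nonneg (add_nonneg ha₀ (mul_nonneg (mul_nonneg hC₉ hCd) (div_nonneg hθ'0.le (sub_pos.mpr hθ').le))) hC₅
  exact ⟨_, hCr, fun c₀ s hs hO' => ne7_of_rate_witness (Adm := R.dom) hUK hCr hθ'0 hθ'1 hθ'Λ hfmtA hfmtB hint hsc
    hposO hoff hS hM hwit hO hvol hl₀ hE ha0 ha1 hSle hRO hrO hW hA hB hZA hZB hpos hs hO'⟩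

/-- **ALL STRINGS, END TO END, ON THE t-CURRENCY TOWER — the term-wise route's capstone for the analytic member's native
outputs.**  As `T4TermwiseDeviation.hasContinuumLimit_of_nodes_witness` with the string-independent tower data read in the
t-currency: node U3's shapes `NE9 Et Wt κ Λ` + `FadingMemory`, `LipBackground Et Wt κ CU` + `PolyLipGrowth CU (1/g_K²) P
q`, `NE5 Et EBt Wt κ θ₅ C₅` on a t-window `Wt` containing both runs' t-tables, NE3 `LocalRate` + `GaugeDominated`, node
U2's output `InjectedRate Cd 0 θc (disc g_K g_{K+1})` AS IS (no box binder; on the analytic member it is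
`T4CurrencyMatching.injectedRate_of_dilationStep`, whose hypotheses are NOT PRINTED); the per-string binders (F) (format,
E-factors evaluated at the t-tables) (S)(M)(O)(O′)(W)(L1-pos)(E1/E2) and the witness (F′).  CONCLUSION: the node-U0 targets
`HasContinuumLimit Sc ∧ HasUniqueLimitPoints Sc ∧ LimitPointsAgree Sc`.  HONEST FRAMING: fixed finite torus, rung (B)+1,
CONDITIONAL on every binder named — NE7 (both halves) NOT PRINTED, the upstream conditionals (BetaPertH-type input behind
node U2, (B), (B^μ)) inside the producers of `hinj` / the weight half as those modules name them; nothing here is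
infinite volume, a mass gap, or the Clay problem. [folklore] -/
theorem hasContinuumLimit_of_nodes_witnessT [RegularGaugeGroup G] {σ : List O → Type} [∀ os, DecidableEq (σ os)]
    {l₀ : ℝ} {vol : List O → ℝ} {K₀ : List O → ℕ} {T : (os : List O) → ℕ → Finset (σ os)}
    {Bad : (os : List O) → ℕ → ℝ → Finset (σ os)} {A B : (os : List O) → ℕ → ℝ → σ os → ℝ}
    {μ : (os : List O) → ℕ → ℝ → σ os → Measure ι} {fac : (os : List O) → ℕ → ℝ → σ os → Finset C.Dom}
    {oA oB : (os : List O) → ℕ → ℝ → σ os → ι → ℝ} {κ₁ S : (os : List O) → ℕ → ℝ → σ os → ℕ → ℝ}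
    {cO RO : (os : List O) → ℕ → ℝ → σ os → ℝ} {rO Wb : List O → ℕ → ℝ}
    (Sc : TorusScheme G O) (hβ : ∀ K, 0 ≤ Sc.β K) (hm : ∀ K o, Measurable (Sc.obs K o))
    (h1 : ∀ K o U, |Sc.obs K o U| ≤ 1) (hl₀ : 0 < l₀)
    (h9 : NE9 Et Wt κ Λm) (hΛm : FadingMemory C₉ ω Λm) (hω : 0 ≤ ω)
    (hUL : LipBackground Et Wt κ CU) (hG : PolyLipGrowth CU (fun K n => invSq (g K n)) P q) (hP : 0 ≤ P)
    (h5 : NE5 Et EBt Wt κ θ₅ C₅) (hθ₅ : 0 ≤ θ₅) (hC₅ : 0 ≤ C₅)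
    (hloc : LocalRate R C₃ θ₃) (hC₃ : 0 ≤ C₃) (hθ₃ : 0 ≤ θ₃) (hθ₃1 : θ₃ < 1) (hgd : GaugeDominated R uA uB)
    (hinj : InjectedRate Cd 0 θc (fun K j => T4CouplingMatching.disc (g K) (g (K + 1)) j)) (hCd : 0 ≤ Cd)
    (hθc : 0 ≤ θc) (htA : ∀ K, (fun n => invSq (g K n)) ∈ Wt)
    (htB : ∀ K, (fun n => invSq (g (K + 1) (n + 1))) ∈ Wt)
    (hθ' : max ω θc < θ') (hθ₅' : θ₅ ≤ θ') (hθ₃' : θ₃ ≤ θ')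
    (hE : 0 ≤ E) (ha0 : 0 < a) (ha1 : a < 1) (hθ'1 : θ' < 1) (hθ'Λ : θ' ≤ Λ)
    (hwit : ∀ K, ∃ v₁ ∈ R.dom, uA K v₁ = oneA ∧ uB K v₁ = oneB)
    (hvol : ∀ os, 0 < vol os)
    (hfmtA : ∀ os K t τ, A os K t τ = ∫ v, (∏ X ∈ fac os K t τ,
      Real.exp (Et (fun n => invSq (g K n)) (uA K v) X - Et (fun n => invSq (g K n)) oneA X)) *
        oA os K t τ v ∂(μ os K t τ))
    (hfmtB : ∀ os K t τ, B os K t τ = ∫ v, (∏ X ∈ fac os K t τ,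
      Real.exp (EBt (fun n => invSq (g (K + 1) (n + 1))) (uB K v) X
        - EBt (fun n => invSq (g (K + 1) (n + 1))) oneB X)) * oB os K t τ v ∂(μ os K t τ))
    (hint : ∀ os K t, |t| ≤ l₀ → ∀ τ ∈ T os K \ Bad os K t,
      Integrable (fun v => (∏ X ∈ fac os K t τ,
        Real.exp (Et (fun n => invSq (g K n)) (uA K v) X - Et (fun n => invSq (g K n)) oneA X)) *
        oA os K t τ v) (μ os K t τ) ∧
      Integrable (fun v => (∏ X ∈ fac os K t τ,
        Real.exp (EBt (fun n => invSq (g (K + 1) (n + 1))) (uB K v) X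
          - EBt (fun n => invSq (g (K + 1) (n + 1))) oneB X)) * oB os K t τ v) (μ os K t τ))
    (hsc : ∀ os K t, |t| ≤ l₀ → ∀ τ ∈ T os K \ Bad os K t, ∀ X ∈ fac os K t τ, C.scale X ≤ K)
    (hposO : ∀ os K t, |t| ≤ l₀ → ∀ τ ∈ T os K \ Bad os K t, ∀ v ∈ R.dom, 0 < oA os K t τ v ∧ 0 < oB os K t τ v)
    (hoff : ∀ os K t, |t| ≤ l₀ → ∀ τ ∈ T os K \ Bad os K t, ∀ v, v ∉ R.dom →
      (∏ X ∈ fac os K t τ,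
        Real.exp (Et (fun n => invSq (g K n)) (uA K v) X - Et (fun n => invSq (g K n)) oneA X)) *
        oA os K t τ v = 0 ∧
      (∏ X ∈ fac os K t τ,
        Real.exp (EBt (fun n => invSq (g (K + 1) (n + 1))) (uB K v) X
          - EBt (fun n => invSq (g (K + 1) (n + 1))) oneB X)) * oB os K t τ v = 0)
    (hS : ∀ os K t, |t| ≤ l₀ → ∀ τ ∈ T os K \ Bad os K t, ∀ v ∈ R.dom, ∀ j ≤ K,
      |(∑ X ∈ fac os K t τ with C.scale X = j,
          (Real.log (Real.exp (EBt (fun n => invSq (g (K + 1) (n + 1))) (uB K v) X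
              - EBt (fun n => invSq (g (K + 1) (n + 1))) oneB X))
            - Real.log (Real.exp (Et (fun n => invSq (g K n)) (uA K v) X
              - Et (fun n => invSq (g K n)) oneA X)))) - κ₁ os K t τ j| ≤ S os K t τ j)
    (hM : ∀ os K t, |t| ≤ l₀ → ∀ τ ∈ T os K \ Bad os K t,
      Multiplicity (fac os K t τ) C.scale (fun X => Real.exp (-(κ * C.d X))) Cw (vol os) Λ K)
    (hO : ∀ os K t, |t| ≤ l₀ → ∀ τ ∈ T os K \ Bad os K t, ∀ v ∈ R.dom,
      |Real.log (oB os K t τ v) - Real.log (oA os K t τ v) - cO os K t τ| ≤ RO os K t τ)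
    (hSle : ∀ os K t, |t| ≤ l₀ → ∀ τ ∈ T os K \ Bad os K t, ∀ j ≤ K,
      S os K t τ j ≤ vol os * (E * a ^ (K - j)))
    (hRO : ∀ os K t, |t| ≤ l₀ → ∀ τ ∈ T os K \ Bad os K t, RO os K t τ ≤ vol os * rO os K)
    (hrO : ∀ os, Summable (rO os))
    (hdevO : ∀ os, ∃ c₀ s : ℕ → ℝ, Summable s ∧
      ∀ K t, |t| ≤ l₀ → ∀ τ ∈ T os K \ Bad os K t, |cO os K t τ - c₀ K| ≤ vol os * s K)
    (hW : ∀ os, T4WeightBudget.RelWeightBound l₀ (T os) (A os) (B os) (Bad os) (Wb os))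
    (hA : ∀ os K t, |t| ≤ l₀ → ∀ τ ∈ T os K, 0 ≤ A os K t τ)
    (hB : ∀ os K t, |t| ≤ l₀ → ∀ τ ∈ T os K, 0 ≤ B os K t τ)
    (hZA : ∀ os K t, |t| ≤ l₀ → T4GenFunBounds.schemeZ Sc os (K₀ os + K) t = ∑ τ ∈ T os K, A os K t τ)
    (hZB : ∀ os K t, |t| ≤ l₀ → T4GenFunBounds.schemeZ Sc os (K₀ os + K + 1) t = ∑ τ ∈ T os K, B os K t τ) :
    HasContinuumLimit Sc ∧ HasUniqueLimitPoints Sc ∧ LimitPointsAgree Sc := by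
  obtain ⟨a₀, ha₀, hUK⟩ := uRateUpTo_of_nodesT h9 hΛm hω hUL hG hP h5 hθ₅ hC₅ hloc hC₃ hθ₃ hθ₃1 hgd hinj hCd hθc
    htA htB hθ' hθ₅' hθ₃'
  have hθ'0 : 0 < θ' := lt_of_le_of_lt (hθc.trans (le_max_right ω θc)) hθ'
  have hC₉ : 0 ≤ C₉ := fadingMemory_const_nonneg hΛm
  have hCr : 0 ≤ a₀ + C₉ * Cd * (θ' / (θ' - max ω θc)) + C₅ :=
    add_nonneg (add_nonneg ha₀ (mul_nonneg (mul_nonneg hC₉ hCd) (div_nonneg hθ'0.le (sub_pos.mpr hθ').le))) hC₅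
  exact hasContinuumLimit_of_rate_witness (Adm := R.dom) Sc hβ hm h1 hl₀ hUK hCr hθ'0 hθ'1 hθ'Λ hE ha0 ha1 hwit hvol
    hfmtA hfmtB hint hsc hposO hoff hS hM hO hSle hRO hrO hdevO hW hA hB hZA hZB

end Currency

/-! ## §5 Sanity: the binder set of §2 is jointly inhabited, with differing runs and a load-bearing witness -/

section Toy

/-- **JOINT NON-VACUITY OF THE LEDGER's BINDER SET WITH A LOAD-BEARING WITNESS** (toy, no physics; answers the reader's
advisory I1 on `T4TermwiseDeviation` v1, GAPS C-pv14-87).  Carriers: one localization domain per creation scale `j`, zero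
tree length, backgrounds = real sequences indexed by scale, identity transport.  Driving fields `v : Bool`: at the WITNESS
`v = false` both runs' background maps return the reference configuration `0`; off the witness the background seen at
scale `j` under cutoff `K` is the fluctuation `a^{K−j}θ^j`.  Run A's E-functional reads the background, `E^A(X; g, U) =
U(X)`, run B's reads it TWICE, `E^B(X; g, U) = 2·U(X)` — so the two runs' E-factors `exp(E(U(v)) − E(0))` DIFFER at every
domain off the witness; the other kinds are trivial (`o ≡ 1`), no bad terms, `|t| ≤ 1`, unit volume.  Then EVERY binder
of `goodClause_summable_of_rate_witness` holds — the composed rate `URateUpTo K` with `Cr = 1`, rate `θ`, `κ = 0`; the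
format (F); the one-run SIZE centring (S) about `κ₁ = 0` with radius `a^{K−j}` (`E = 1`); multiplicity (M) with
`Cw = Λ = 1`; the witness (F′); (O), (O′) with zero radii — and the theorem yields the good clause with the summable
remainder `δ′_K = 2·(2·Σ_{m+n=K} min(a^n, θ^m))`.  The witness is load-bearing in the sense of `T4TermwiseDeviation`'s
negative side (`sliceCentre_sum_fails_without_sizeCentre` / `_rateCentre`): no two-run CENTRE is supplied here, the
E-group's centres are produced by the theorem. [folklore] -/
theorem toy_rate_witness_nonvacuous {a θ : ℝ} (ha0 : 0 < a) (ha1 : a < 1) (hθ0 : 0 < θ) (hθ1 : θ < 1) :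
    GoodClause (1 : ℝ) 1 (fun _ => (Finset.univ : Finset Unit))
        (fun K _ _ => ∫ b, (∏ j ∈ range (K + 1), Real.exp ((bif b then a ^ (K - j) * θ ^ j else 0) - 0)) * 1
          ∂(Measure.dirac true))
        (fun K _ _ => ∫ b, (∏ j ∈ range (K + 1),
          Real.exp (2 * (bif b then a ^ (K - j) * θ ^ j else 0) - 2 * 0)) * 1 ∂(Measure.dirac true))
        (fun _ _ => ∅)
        (fun K => (max 1 1 * ((1 + 1) * ∑ x ∈ antidiagonal K, min (a ^ x.2) (θ ^ x.1 * 1 ^ x.2)) + 0)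
          + (max 1 1 * ((1 + 1) * ∑ x ∈ antidiagonal K, min (a ^ x.2) (θ ^ x.1 * 1 ^ x.2)) + 0)) ∧
      Summable (fun K : ℕ =>
        (max (1 : ℝ) 1 * ((1 + 1) * ∑ x ∈ antidiagonal K, min (a ^ x.2) (θ ^ x.1 * 1 ^ x.2)) + 0)
          + (max 1 1 * ((1 + 1) * ∑ x ∈ antidiagonal K, min (a ^ x.2) (θ ^ x.1 * 1 ^ x.2)) + 0)) := by
  -- the toy fluctuation seen at scale `j` under cutoff `K`: `a^{K−j} θ^j` off the witness, `0` at the witness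
  have key : ∀ (K j : ℕ) (v : Bool),
      0 ≤ (bif v then a ^ (K - j) * θ ^ j else 0) ∧ (bif v then a ^ (K - j) * θ ^ j else 0) ≤ a ^ (K - j) * θ ^ j := by
    intro K j v
    cases v
    · refine ⟨le_rfl, ?_⟩
      show (0 : ℝ) ≤ a ^ (K - j) * θ ^ j
      positivity
    · refine ⟨?_, le_rfl⟩
      show (0 : ℝ) ≤ a ^ (K - j) * θ ^ j
      positivity
  have hslice : ∀ (K j : ℕ) (f : ℕ → ℝ), j ≤ K → ∑ X ∈ range (K + 1) with X = j, f X = f j := fun K j f hj => by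
    rw [Finset.filter_eq', if_pos (mem_range.mpr (Nat.lt_succ_of_le hj)), sum_singleton]
  refine goodClause_summable_of_rate_witness
    (C := ⟨ℕ, fun k => k, fun _ => 0, fun _ => le_rfl, ℕ → ℝ, ℕ → ℝ, fun _ _ => 0, fun _ _ => le_rfl, fun U => U⟩)
    (ι := Bool) (σ := Unit) (l₀ := 1) (vol := 1) (T := fun _ => Finset.univ) (Bad := fun _ _ => ∅)
    (μ := fun _ _ _ => Measure.dirac true) (fac := fun K _ _ => range (K + 1)) (Adm := Set.univ)
    (EA := fun _ U X => U X) (EB := fun _ U X => 2 * U X) (κ := 0) (θ' := θ) (Cr := 1)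
    (gA := fun _ _ => 0) (gB := fun _ _ => 0)
    (uA := fun K b X => bif b then a ^ (K - X) * θ ^ X else 0)
    (uB := fun K b X => bif b then a ^ (K - X) * θ ^ X else 0)
    (oneA := fun _ => 0) (oneB := fun _ => 0) (oA := fun _ _ _ _ => 1) (oB := fun _ _ _ _ => 1)
    (κ₁ := fun _ _ _ _ => 0) (S := fun K _ _ j => a ^ (K - j)) (cO := fun _ _ _ => 0) (RO := fun _ _ _ => 0)
    (rO := fun _ => 0) (c₀ := fun _ => 0) (s := fun _ => 0) (Cw := 1) (E := 1) (a := a) (Λ := 1)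
    ?_ zero_le_one hθ0 hθ1 hθ1.le (fun _ _ _ => rfl) (fun _ _ _ => rfl)
    (fun _ _ _ _ _ => ⟨Integrable.of_finite, Integrable.of_finite⟩)
    (fun K _ _ _ _ X hX => Nat.le_of_lt_succ (mem_range.mp hX))
    (fun _ _ _ _ _ _ _ => ⟨one_pos, one_pos⟩)
    (fun _ _ _ _ _ v hv => absurd (Set.mem_univ v) hv)
    ?_ ?_ (fun K => ⟨false, Set.mem_univ _, rfl, rfl⟩)
    (fun _ _ _ _ _ _ _ => by rw [Real.log_one, sub_zero, sub_zero, abs_zero])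
    zero_le_one zero_le_one ha0 ha1
    (fun K _ _ _ _ j _ => by rw [one_mul, one_mul])
    (fun _ _ _ _ _ => by rw [mul_zero])
    summable_zero summable_zero
    (fun _ _ _ _ _ => by rw [sub_zero, abs_zero, mul_zero])
  · -- (T-rate) the composed tower rate, here with `Cr = 1`, rate `θ`, `κ = 0`
    intro K v _ X hX
    obtain ⟨h0, hle⟩ := key K X v
    dsimp only
    rw [show (bif v then a ^ (K - X) * θ ^ X else 0) - 2 * (bif v then a ^ (K - X) * θ ^ X else 0)
        = -(bif v then a ^ (K - X) * θ ^ X else 0) by ring, abs_neg, abs_of_nonneg h0, zero_mul, neg_zero,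
      Real.exp_zero, mul_one, one_mul]
    exact hle.trans (mul_le_of_le_one_left (pow_nonneg hθ0.le _) (pow_le_one₀ ha0.le ha1.le))
  · -- (S) one-run size centring about `0` with radius `a^{K−j}`
    intro K t _ τ _ v _ j hj
    obtain ⟨h0, hle⟩ := key K j v
    dsimp only
    rw [hslice K j _ hj, Real.log_exp, Real.log_exp, sub_zero, mul_zero, sub_zero, sub_zero,
      show 2 * (bif v then a ^ (K - j) * θ ^ j else 0) - (bif v then a ^ (K - j) * θ ^ j else 0)
        = (bif v then a ^ (K - j) * θ ^ j else 0) by ring, abs_of_nonneg h0]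
    exact hle.trans (mul_le_of_le_one_right (pow_nonneg ha0.le _) (pow_le_one₀ hθ0.le hθ1.le))
  · -- (M) multiplicity: one domain per creation scale
    intro K t _ τ _ j hj
    dsimp only
    rw [hslice K j _ hj, zero_mul, neg_zero, Real.exp_zero, one_mul, one_mul, one_pow]

end Toy

end Literature.MathematicalPhysics.QuantumFieldTheory.Balaban1983to89.T4TermwiseCurrency
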